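import Summits.Ventures.PercRepro.SevenThreeNrk

/-!
# PercRepro — the `(7,3)` cell: the series relation of a finset (p3, gen 16)

For a finset `A ⊆ E` the non-coloops of `M|A` are its cyclic part `K(A)` (`SevenThreeCyclic.lean`). Two non-coloops
`e ≠ f` are IN SERIES in `A` when removing both drops the rank by one only: `ρ(A ∖ {e, f}) + 1 = ρ(A)` (`Ser`) — the
parallel relation of the dual `(M|A)✶`, stated primally. This file proves, with the natural-number rank `nrk` of
`SevenThreeNrk.lean`:
* `Ser` is an equivalence relation on the cyclic part (`ser_trans`: submodularity on `A ∖ {e,f}` and `A ∖ {f,g}`);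
* `nrk_sdiff_of_pairwise_ser`: removing a nonempty set `V` of pairwise series points drops the rank by exactly one,
  `ρ(A ∖ V) + |V| = ρ(A) + 1` (induction on `V`, submodularity against a series pair);
* `nrk_sdiff_add_card_ge_of_not_ser`: removing a set containing two non-series points drops the rank by at most
  `|V| − 2`, `ρ(A ∖ V) + |V| ≥ ρ(A) + 2`;
* `nrk_sdiff_union_coloops`: coloops of `A` drop the rank by exactly one each, from any subset of `A` containing them.
With `drk A V := ρ(A ∖ V) + |V| − ρ(A)` (the rank of `V` in the dual of `M|A`) this is the complete description of the
dual rank of a subset: `0` on the coloops, `1` on a nonempty subset of one series class, `≥ 2` across two classes.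
(`P3-C025-seven-three-plan.md` §9 (R2)–(R4): the line classes are the series classes of the world `E = T ∪ W`, the star
classes those of the cyclic part of a nullity-two witness.)
-/

namespace PercRepro

namespace SevenThree

open Finset ThmH SixThree

variable {α : Type*} [DecidableEq α] {M : Matroid α} [M.Finite]

/-- Two points of `A` are IN SERIES when they coincide or removing both drops the rank by exactly one. -/
def Ser (M : Matroid α) [M.Finite] (A : Finset α) (e f : α) : Prop :=
  e = f ∨ nrk M (A \ {e, f}) + 1 = nrk M A

/-- `A ∖ {e, f} = (A.erase f).erase e`. -/
theorem sdiff_pair_eq_erase_erase (A : Finset α) (e f : α) : A \ {e, f} = (A.erase f).erase e := by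
  rw [Finset.sdiff_insert, Finset.sdiff_singleton_eq_erase]

/-- Removing a pair drops the rank by at most two. -/
theorem nrk_le_nrk_sdiff_pair_add_two (A : Finset α) (e f : α) : nrk M A ≤ nrk M (A \ {e, f}) + 2 := by
  have h := nrk_le_nrk_sdiff_add_card (M := M) A {e, f}
  have hc : ({e, f} : Finset α).card ≤ 2 := Finset.card_le_two
  omega

/-- Removing a pair containing a non-coloop `e` drops the rank by at most one. -/
theorem nrk_le_nrk_sdiff_pair_add_one {A : Finset α} (hA : A ⊆ gr M) {e : α} (he : e ∈ cyclicPart M A) (f : α) :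
    nrk M A ≤ nrk M (A \ {e, f}) + 1 := by
  rw [Finset.pair_comm, sdiff_pair_eq_erase_erase]
  have h1 := (mem_cyclicPart_iff_nrk hA).1 he
  have h2 := nrk_le_nrk_erase_add_one (M := M) (A.erase e) f
  omega

/-- `Ser` is reflexive. -/
theorem ser_refl (A : Finset α) (e : α) : Ser M A e e := Or.inl rfl

/-- `Ser` is symmetric. -/
theorem ser_symm {A : Finset α} {e f : α} (h : Ser M A e f) : Ser M A f e := by
  rcases h with h | h
  · exact Or.inl h.symm
  · right
    rw [Finset.pair_comm]
    exact h

/-- Two distinct non-series non-coloops: removing both does not drop the rank. -/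
theorem nrk_sdiff_pair_of_not_ser {A : Finset α} (hA : A ⊆ gr M) {e f : α} (he : e ∈ cyclicPart M A)
    (h : ¬ Ser M A e f) : nrk M (A \ {e, f}) = nrk M A := by
  have h1 := nrk_le_nrk_sdiff_pair_add_one hA he f
  have h2 : nrk M (A \ {e, f}) ≤ nrk M A := nrk_mono Finset.sdiff_subset
  have h3 : nrk M (A \ {e, f}) + 1 ≠ nrk M A := fun hh => h (Or.inr hh)
  omega

/-- `Ser` is transitive on the cyclic part (submodularity on `A ∖ {e, f}` and `A ∖ {f, g}`). -/
theorem ser_trans {A : Finset α} (hA : A ⊆ gr M) {e f g : α} (he : e ∈ cyclicPart M A) (hf : f ∈ cyclicPart M A)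
    (hef : Ser M A e f) (hfg : Ser M A f g) : Ser M A e g := by
  rcases hef with rfl | hef
  · exact hfg
  rcases hfg with rfl | hfg
  · exact Or.inr hef
  by_cases heg : e = g
  · exact Or.inl heg
  right
  have hfA : f ∈ A := (mem_cyclicPart_iff_nrk hA).1 hf |>.1
  have hfr : nrk M (A.erase f) = nrk M A := (mem_cyclicPart_iff_nrk hA).1 hf |>.2
  -- submodularity on `A ∖ {e,f}` and `A ∖ {f,g}`
  have hunion : (A \ {e, f}) ∪ (A \ {f, g}) = A.erase f := by
    ext x
    simp only [Finset.mem_union, Finset.mem_sdiff, Finset.mem_insert, Finset.mem_singleton, Finset.mem_erase]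
    constructor
    · rintro (⟨hx, h⟩ | ⟨hx, h⟩)
      · exact ⟨fun hh => h (Or.inr hh), hx⟩
      · exact ⟨fun hh => h (Or.inl hh), hx⟩
    · rintro ⟨hxf, hx⟩
      by_cases hxe : x = e
      · exact Or.inr ⟨hx, fun hh => by rcases hh with hh | hh <;> [exact hxf hh; exact heg (hxe.symm.trans hh)]⟩
      · exact Or.inl ⟨hx, fun hh => by rcases hh with hh | hh <;> [exact hxe hh; exact hxf hh]⟩
  have hinter : (A \ {e, f}) ∩ (A \ {f, g}) = A \ {e, f, g} := by
    ext x
    simp only [Finset.mem_inter, Finset.mem_sdiff, Finset.mem_insert, Finset.mem_singleton]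
    tauto
  have hsub := nrk_submod (M := M) (A \ {e, f}) (A \ {f, g})
  rw [hunion, hinter, hfr] at hsub
  -- `A ∖ {e, g} ⊆` ... `nrk (A ∖ {e,g}) ≤ nrk (A ∖ {e,f,g}) + 1`
  have h3 : nrk M (A \ {e, g}) ≤ nrk M (A \ {e, f, g}) + 1 := by
    have hsub' : (A \ {e, g}) \ {f} = A \ {e, f, g} := by
      ext x
      simp only [Finset.mem_sdiff, Finset.mem_insert, Finset.mem_singleton]
      tauto
    have := nrk_le_nrk_sdiff_add_card (M := M) (A \ {e, g}) {f}
    rw [hsub', Finset.card_singleton] at this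
    exact this
  have h4 := nrk_le_nrk_sdiff_pair_add_one hA he g
  omega

/-- **(S2)** Removing a nonempty set of pairwise series non-coloops drops the rank by exactly one:
`nrk (A ∖ V) + |V| = nrk A + 1`. -/
theorem nrk_sdiff_of_pairwise_ser {A V : Finset α} (hA : A ⊆ gr M) (hV : V ⊆ cyclicPart M A) (hne : V.Nonempty)
    (hser : ∀ e ∈ V, ∀ f ∈ V, Ser M A e f) : nrk M (A \ V) + V.card = nrk M A + 1 := by
  classical
  -- induction on `V`
  induction V using Finset.strongInduction with
  | H V ih =>
  obtain ⟨e, he⟩ := hne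
  by_cases h1 : V = {e}
  · subst h1
    rw [Finset.sdiff_singleton_eq_erase, Finset.card_singleton]
    have := (mem_cyclicPart_iff_nrk hA).1 (hV he)
    omega
  obtain ⟨f, hf, hfe⟩ : ∃ f ∈ V, f ≠ e := by
    by_contra hcon
    exact h1 (Finset.eq_singleton_iff_unique_mem.2 ⟨he, fun x hx => by
      by_contra hxe
      exact hcon ⟨x, hx, hxe⟩⟩)
  by_cases h2 : V = {e, f}
  · subst h2
    have hc : ({e, f} : Finset α).card = 2 := Finset.card_pair (Ne.symm hfe)
    rcases hser e (by simp) f (by simp) with h | h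
    · exact absurd h.symm hfe
    · omega
  -- `V = insert g V'` with `|V'| ≥ 2`: pick `g ∈ V ∖ {e, f}`
  obtain ⟨g, hg, hge⟩ : ∃ g ∈ V, g ∉ ({e, f} : Finset α) := by
    by_contra hcon
    apply h2
    apply Finset.Subset.antisymm (fun x hx => by
      by_contra hx'
      exact hcon ⟨x, hx, hx'⟩)
    intro x hx
    rw [Finset.mem_insert, Finset.mem_singleton] at hx
    rcases hx with rfl | rfl
    · exact he
    · exact hf
  set V' := V.erase g with hV'
  have hgV' : g ∉ V' := Finset.notMem_erase g V
  have hVins : V = insert g V' := (Finset.insert_erase hg).symm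
  have heV' : e ∈ V' := Finset.mem_erase.2 ⟨fun h => hge (h ▸ by simp), he⟩
  have hfV' : f ∈ V' := Finset.mem_erase.2 ⟨fun h => hge (h ▸ by simp), hf⟩
  have hV'sub : V' ⊆ cyclicPart M A := (Finset.erase_subset g V).trans hV
  have hV'lt : V' ⊂ V := Finset.erase_ssubset hg
  have ih' := ih V' hV'lt hV'sub ⟨e, heV'⟩ (fun a ha b hb => hser a (Finset.mem_of_mem_erase ha) b (Finset.mem_of_mem_erase hb))
  -- submodularity on `A ∖ V'` and `A ∖ {e, g}`
  have hseg : nrk M (A \ {e, g}) + 1 = nrk M A := by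
    rcases hser e he g hg with h | h
    · exact absurd (h ▸ by simp : g ∈ ({e, f} : Finset α)) hge
    · exact h
  have hunion : (A \ V') ∪ (A \ {e, g}) = A.erase e := by
    ext x
    simp only [Finset.mem_union, Finset.mem_sdiff, Finset.mem_insert, Finset.mem_singleton, Finset.mem_erase]
    constructor
    · rintro (⟨hx, h⟩ | ⟨hx, h⟩)
      · exact ⟨fun hh => h (hh ▸ heV'), hx⟩
      · exact ⟨fun hh => h (Or.inl hh), hx⟩
    · rintro ⟨hxe, hx⟩
      by_cases hxg : x = g
      · exact Or.inl ⟨hx, fun hh => hgV' (hxg ▸ hh)⟩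
      · exact Or.inr ⟨hx, fun hh => by rcases hh with hh | hh <;> [exact hxe hh; exact hxg hh]⟩
  have hinter : (A \ V') ∩ (A \ {e, g}) = A \ V := by
    ext x
    simp only [Finset.mem_inter, Finset.mem_sdiff, Finset.mem_insert, Finset.mem_singleton]
    constructor
    · rintro ⟨⟨hx, h⟩, ⟨-, h'⟩⟩
      refine ⟨hx, fun hxV => ?_⟩
      rw [hVins, Finset.mem_insert] at hxV
      rcases hxV with rfl | hxV
      · exact h' (Or.inr rfl)
      · exact h hxV
    · rintro ⟨hx, h⟩
      refine ⟨⟨hx, fun hh => h (Finset.mem_of_mem_erase hh)⟩, ⟨hx, fun hh => ?_⟩⟩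
      rcases hh with rfl | rfl
      · exact h he
      · exact h hg
  have hsub := nrk_submod (M := M) (A \ V') (A \ {e, g})
  rw [hunion, hinter, ((mem_cyclicPart_iff_nrk hA).1 (hV he)).2] at hsub
  -- lower bound: `nrk (A ∖ V') ≤ nrk (A ∖ V) + 1`
  have hlow : nrk M (A \ V') ≤ nrk M (A \ V) + 1 := by
    have hsd : (A \ V') \ {g} = A \ V := by
      ext x
      simp only [Finset.mem_sdiff, Finset.mem_singleton, hVins, Finset.mem_insert]
      tauto
    have := nrk_le_nrk_sdiff_add_card (M := M) (A \ V') {g}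
    rw [hsd, Finset.card_singleton] at this
    exact this
  have hcard : V.card = V'.card + 1 := by
    rw [hVins, Finset.card_insert_of_notMem hgV']
  omega

/-- **(S3)** A set containing two distinct non-series points (one of them a non-coloop) drops the rank by at most
`|V| − 2`: `nrk A + 2 ≤ nrk (A ∖ V) + |V|`. -/
theorem nrk_sdiff_add_card_ge_of_not_ser {A V : Finset α} (hA : A ⊆ gr M) {e f : α} (he : e ∈ cyclicPart M A)
    (heV : e ∈ V) (hfV : f ∈ V) (hne : e ≠ f) (h : ¬ Ser M A e f) : nrk M A + 2 ≤ nrk M (A \ V) + V.card := by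
  have h1 := nrk_sdiff_pair_of_not_ser hA he h
  have h2 := nrk_le_nrk_sdiff_add_card (M := M) (A \ {e, f}) (V \ {e, f})
  have h3 : (A \ {e, f}) \ (V \ {e, f}) = A \ V := by
    ext x
    simp only [Finset.mem_sdiff, Finset.mem_insert, Finset.mem_singleton]
    constructor
    · rintro ⟨⟨hx, h⟩, h'⟩
      exact ⟨hx, fun hxV => h' ⟨hxV, h⟩⟩
    · rintro ⟨hx, hxV⟩
      refine ⟨⟨hx, fun hh => ?_⟩, fun hh => hxV hh.1⟩
      rcases hh with rfl | rfl
      · exact hxV heV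
      · exact hxV hfV
  have h4 : (V \ {e, f}).card + 2 = V.card := by
    have hpair : ({e, f} : Finset α) ⊆ V := by
      intro x hx
      rw [Finset.mem_insert, Finset.mem_singleton] at hx
      rcases hx with rfl | rfl
      · exact heV
      · exact hfV
    rw [Finset.card_sdiff_of_subset hpair, Finset.card_pair hne]
    have := Finset.card_le_card hpair
    rw [Finset.card_pair hne] at this
    omega
  rw [h3] at h2
  omega

/-- Removing coloops of `A` from `A ∖ V` (disjoint from `V`) drops the rank by exactly one each. -/
theorem nrk_sdiff_union_coloops {A V Y : Finset α} (hA : A ⊆ gr M) (hY : Y ⊆ coloopsOf M A) (hVY : Disjoint V Y) :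
    nrk M (A \ (V ∪ Y)) + Y.card = nrk M (A \ V) := by
  classical
  induction Y using Finset.induction_on with
  | empty => simp
  | insert y Y hyY ih =>
    have hY' : Y ⊆ coloopsOf M A := (Finset.subset_insert y Y).trans hY
    have hVY' : Disjoint V Y := hVY.mono_right (Finset.subset_insert y Y)
    have ih' := ih hY' hVY'
    have hyA : y ∈ A := coloopsOf_subset M A (hY (Finset.mem_insert_self y Y))
    have hyV : y ∉ V := Finset.disjoint_right.1 hVY (Finset.mem_insert_self y Y)
    have hyB : y ∈ A \ (V ∪ Y) := by
      rw [Finset.mem_sdiff, Finset.mem_union]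
      exact ⟨hyA, fun hh => by rcases hh with hh | hh <;> [exact hyV hh; exact hyY hh]⟩
    have hdrop := nrk_erase_add_one_of_coloop hA (Finset.sdiff_subset) (hY (Finset.mem_insert_self y Y)) hyB
    have heq : A \ (V ∪ insert y Y) = (A \ (V ∪ Y)).erase y := by
      ext x
      simp only [Finset.mem_sdiff, Finset.mem_union, Finset.mem_insert, Finset.mem_erase]
      tauto
    rw [heq, Finset.card_insert_of_notMem hyY]
    omega

/-- The DUAL RANK of `V` in `A`: `drk A V = nrk (A ∖ V) + |V| − nrk A`. -/
noncomputable def drk (M : Matroid α) [M.Finite] (A V : Finset α) : ℕ := nrk M (A \ V) + V.card - nrk M A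

/-- The defining identity of `drk`. -/
theorem nrk_sdiff_add_card_eq (A V : Finset α) : nrk M (A \ V) + V.card = nrk M A + drk M A V := by
  unfold drk
  have := nrk_le_nrk_sdiff_add_card (M := M) A V
  omega

/-- `drk A ∅ = 0`. -/
theorem drk_empty (A : Finset α) : drk M A ∅ = 0 := by
  unfold drk
  simp

/-- `drk` ignores the coloops: `drk A (V ∪ Y) = drk A V` for `Y ⊆ coloops(A)` disjoint from `V`. -/
theorem drk_union_coloops {A V Y : Finset α} (hA : A ⊆ gr M) (hY : Y ⊆ coloopsOf M A) (hVY : Disjoint V Y) :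
    drk M A (V ∪ Y) = drk M A V := by
  have h1 := nrk_sdiff_add_card_eq (M := M) A (V ∪ Y)
  have h2 := nrk_sdiff_add_card_eq (M := M) A V
  have h3 := nrk_sdiff_union_coloops hA hY hVY
  rw [Finset.card_union_of_disjoint hVY] at h1
  omega

/-- **(S2′)** `drk A V = 1` for a nonempty set of pairwise series non-coloops. -/
theorem drk_eq_one_of_pairwise_ser {A V : Finset α} (hA : A ⊆ gr M) (hV : V ⊆ cyclicPart M A) (hne : V.Nonempty)
    (hser : ∀ e ∈ V, ∀ f ∈ V, Ser M A e f) : drk M A V = 1 := by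
  have h1 := nrk_sdiff_add_card_eq (M := M) A V
  have h2 := nrk_sdiff_of_pairwise_ser hA hV hne hser
  omega

/-- **(S3′)** `2 ≤ drk A V` when `V` contains two distinct non-series points (one a non-coloop). -/
theorem two_le_drk_of_not_ser {A V : Finset α} (hA : A ⊆ gr M) {e f : α} (he : e ∈ cyclicPart M A) (heV : e ∈ V)
    (hfV : f ∈ V) (hne : e ≠ f) (h : ¬ Ser M A e f) : 2 ≤ drk M A V := by
  have h1 := nrk_sdiff_add_card_eq (M := M) A V
  have h2 := nrk_sdiff_add_card_ge_of_not_ser hA he heV hfV hne h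
  omega

/-- A subset of the cyclic part with `drk ≤ 1` is pairwise series. -/
theorem pairwise_ser_of_drk_le_one {A V : Finset α} (hA : A ⊆ gr M) (hV : V ⊆ cyclicPart M A) (h : drk M A V ≤ 1) :
    ∀ e ∈ V, ∀ f ∈ V, Ser M A e f := by
  intro e he f hf
  by_contra hns
  have hne : e ≠ f := fun hh => hns (Or.inl hh)
  have := two_le_drk_of_not_ser hA (hV he) he hf hne hns
  omega

/-- `drk A V ≥ 1` for a nonempty subset of the cyclic part. -/
theorem one_le_drk_of_nonempty {A V : Finset α} (hA : A ⊆ gr M) (hV : V ⊆ cyclicPart M A) (hne : V.Nonempty) :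
    1 ≤ drk M A V := by
  obtain ⟨e, he⟩ := hne
  have h1 := nrk_sdiff_add_card_eq (M := M) A V
  have h2 : nrk M (A.erase e) ≤ nrk M (A \ V) + (V.erase e).card := by
    have hsd : (A.erase e) \ (V.erase e) = A \ V := by
      ext x
      simp only [Finset.mem_sdiff, Finset.mem_erase]
      constructor
      · rintro ⟨⟨hxe, hxA⟩, hx⟩
        exact ⟨hxA, fun hxV => hx ⟨hxe, hxV⟩⟩
      · rintro ⟨hxA, hxV⟩
        exact ⟨⟨fun hxe => hxV (hxe ▸ he), hxA⟩, fun hh => hxV hh.2⟩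
    have := nrk_le_nrk_sdiff_add_card (M := M) (A.erase e) (V.erase e)
    rw [hsd] at this
    exact this
  have h3 := ((mem_cyclicPart_iff_nrk hA).1 (hV he)).2
  have h4 := Finset.card_erase_add_one he
  omega

end SevenThree

end PercRepro
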